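import Summits.HodgeConjecture.HodgeConjecture.Theorems.F0P3cDyRamTableDiagWitnesses     -- ★ (this seat): the reference transvections and the integral regular unipotent (generic); brings ★ ShellLabelPlus, ★ UnipotentLabelInjOn (`isConj_of_…`), ★ DOfPlaceOfDatum
import Literature.NumberTheory.Automorphic.UnitaryLevelTwoInteriorRelabel                    -- ★ `mem_cmLocalIntegralLevel_iff_isIntMatrix` (`K`-membership ↔ `ψ`-integrality)
import Literature.NumberTheory.Automorphic.AdicCompletionIntegersAdicComplete                -- ★ `isAdicComplete_valuedMaximalIdeal_valuedInteger_adicCompletion` (`IsAdicComplete 𝓂[L_w] 𝒪[L_w]`)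
import HarnessLib

/-!
# Crux `H413`, line LH4 «(D-RAM) FOUR-FRAME», tier 2 under `U4_Rows` §2 (iv-a)·T3: EVERY UNIPOTENT CLASS OF `U(Φ₃)(L⁺_v)` MEETS THE SUPPORT OF ITS OWN PIECE —
# conjugates in `K ∩ {shell ∧ LabelPlus}`, `K ∩ {shell ∧ ¬LabelPlus}`, `K ∩ {X² ∉ ϖ^{m*}M₃(𝒪)}` for the class-`+` ∕ class-`−` transvection classes and the regular class

Cell `hodgecm-mathlib` (D-0151), FLOOR 0, crux item H413 = `stmt-HodgeConjecture-24833`, route of record `HCCMUnconditional`; squad F0∕P3c∕LH4, Track A; dealer LH4-plan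
(g10) WORD #17∕#18 (U4 §2 T3 `stub_U4_table_diag_ne_zero` → LH4-p03); tier-2 hand LH4-p03 (g11).  THEOREMS ONLY (no `def`, no instance, no notation, no `sorry`, default
heartbeats); lane `--supports stmt-HodgeConjecture-24833 --as helper`.

THE MATHEMATICS ([Rogawski1990] §3.9, Prop. 3.9.1; the wild place enters only through the sheet datum).  `ψ = localNonsplitEquiv : G = U(Φ₃)(L⁺_v) ≃ U(σ_w, Φ₃)(L_w)`,
`K = cmLocalIntegralLevel` = `ψ⁻¹(GL₃(𝒪_w))` (★ `mem_cmLocalIntegralLevel_iff_isIntMatrix`).  §1 turns an integral `Φ₃`-unitary matrix with integral inverse into an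
element of `K` with that `ψ`-image.  §2: a class-`+` transvection `γ` (`X ≠ 0`, `X² = 0`, `NormClassPlus`) is conjugate (★ `isConj_of_normClassPlus`) to `g₊ = ψ⁻¹ n(t₊) ∈ K`,
whose `X = xPlus` is on the shell with `LabelPlus`; a class-`−` transvection is conjugate (★ `isConj_of_not_normClassPlus`, ramified place, norm index two) to
`g₋ = ψ⁻¹ n(εt₊) ∈ K`, `ε` a `σ_w`-fixed UNIT non-norm (★ `IsCMField.exists_fixed_nonnorm_dichotomy`, rescaled by `N(ϖ)^n`), whose `X = ε • xPlus` is on the shell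
WITHOUT `LabelPlus` (★ `not_labelPlus_smul_xPlus`, `IsAdicComplete 𝓂[L_w] 𝒪[L_w]` ★); a regular unipotent `γ` (`X² ≠ 0`, `(γ−1)³ = 0`) is conjugate (★
`exists_conj_eq_of_regular_unipotent` — both `ψγ` and `u(a,b)` are `U(σ_w,Φ₃)`-conjugate to `u(1, −1∕2)` — read back through ★ `isConj_of_conj_conj_eq`) to
`g_reg = ψ⁻¹ u(a, b) ∈ K` with `(u(a,b) − 1)² ∉ ϖ^{m*} M₃(𝒪_w)` (★ `exists_regular_entries`).

* §1 `exists_mem_level_coe_eq` (integral unitary matrix ↦ element of `K`).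
* §2 **`exists_conj_mem_transvPlus`**, **`exists_conj_mem_transvMinus`**, **`exists_conj_mem_reg`** — the three witnesses `y·γ·y⁻¹ ∈ supp(piece)`.

HONEST LABEL.  Count-neutral helper (no stub paid here; the T3 payer is the next file).  (D-RAM) verdict of record PRINT [LanglandsShelstad1989 Thm. p. 484 ∕ Rogawski1990
Prop. 4.9.1 (a)] ∕ XL; `HC_CM` is proved only modulo the 7 printed citations (2 remaining: hLiu418 = `stmt-HodgeConjecture-24832`, h413 = `stmt-HodgeConjecture-24833`) until
rung 0 closes.
-/

noncomputable section

namespace Summit.HodgeConjecture.HodgeConjecture.Cruxes.H413.F0P3cDyRamTableDiagConjugates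

open NumberField IsDedekindDomain
open Literature.NumberTheory.Automorphic Literature.NumberTheory.Automorphic.UnitaryGroup
open Literature.NumberTheory.Automorphic.UnitaryLatticeTree Literature.NumberTheory.Automorphic.HermitianLattice
open Literature.NumberTheory.Automorphic.UnitaryThreeFourFrame
open Literature.NumberTheory.Rogawski1990 Literature.NumberTheory.GaloisRepresentations
open Literature.NumberTheory.LocalFields Literature.NumberTheory.LocalFields.WildQuadraticDatum
open Summit.HodgeConjecture.HodgeConjecture.Cruxes.H413.F0P3cDyRamFourFramePieces
open Summit.HodgeConjecture.HodgeConjecture.Cruxes.H413.F0P3cDyRamFourFrameUnipotentLabelDefs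
open Summit.HodgeConjecture.HodgeConjecture.Cruxes.H413.F0P3cDyRamPiecesShellLemmas
open Summit.HodgeConjecture.HodgeConjecture.Cruxes.H413.F0P3cDyRamTableDiagWitnesses
open Summit.HodgeConjecture.HodgeConjecture.Cruxes.H413.F0P3cDyRamUnipotentLabelInjOn
open Summit.HodgeConjecture.HodgeConjecture.Cruxes.H413.F0P3cDyRamWildPlaceDatum (exists_isRamifiedQuadraticDatum_of_placesOver)
open Summit.HodgeConjecture.HodgeConjecture.Cruxes.H413.F0P3cDyRamDOfPlaceOfDatum (dOfPlace_eq_of_isRamifiedQuadraticDatum mstarFn_eq_of_isRamifiedQuadraticDatum)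
open Summit.HodgeConjecture.HodgeConjecture.Cruxes.H413 (F0P3cDyRamProfilePiecesProps.coe_mem_unitaryGroupOfForm_over)
open scoped Matrix MatrixGroups Valued
open WithZero

variable (L : Type) [Field L] [NumberField L] [IsCMField L] {v : HeightOneSpectrum (𝓞 ↥(maximalRealSubfield L))}
  (w : UnitaryGroup.PlacesOver L v) (hw : IsCMField.complexConj L • w.1 = w.1)

/-! ## §1  Integral unitary matrices are `ψ`-images of elements of `K` -/

/-- **An integral `Φ₃`-unitary matrix with integral inverse is `ψ x` for some `x ∈ K`** (`ψ = localNonsplitEquiv` is onto `U(σ_w, Φ₃)(L_w)`; `K`-membership is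
`ψ`-integrality, ★ `mem_cmLocalIntegralLevel_iff_isIntMatrix`). -/
theorem exists_mem_level_coe_eq {g : GL (Fin 3) (w.1.adicCompletion L)}
    (hU : g ∈ unitaryGroupOfForm (galAdicCompletionMap (L := L) (IsCMField.complexConj L) hw) ((StdForm.antidiagonal 3).over (w.1.adicCompletion L)))
    (hg : IsIntMatrix (g : Matrix (Fin 3) (Fin 3) (w.1.adicCompletion L))) (hginv : IsIntMatrix ((g⁻¹ : GL (Fin 3) (w.1.adicCompletion L)) : Matrix (Fin 3) (Fin 3) (w.1.adicCompletion L))) :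
    ∃ x : ((UnitaryGroup.cmDatum L 3 (Matrix.of fun i j : Fin 3 => if i.val + j.val + 1 = 3 then (1 : L) else 0)).Local v),
      x ∈ cmLocalIntegralLevel L 3 (Matrix.of fun i j : Fin 3 => if i.val + j.val + 1 = 3 then (1 : L) else 0) v ∧
      ((localNonsplitEquiv (IsCMField.complexConj L) (Matrix.of fun i j : Fin 3 => if i.val + j.val + 1 = 3 then (1 : L) else 0) (IsCMField.complexConj_ne_one L) w hw x :
        ↥(unitaryGroupOfForm (galAdicCompletionMap (L := L) (IsCMField.complexConj L) hw) (placeForm (Matrix.of fun i j : Fin 3 => if i.val + j.val + 1 = 3 then (1 : L) else 0) w.1))) :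
          GL (Fin 3) (w.1.adicCompletion L)) = g := by
  have hU' : g ∈ unitaryGroupOfForm (galAdicCompletionMap (L := L) (IsCMField.complexConj L) hw) (placeForm (Matrix.of fun i j : Fin 3 => if i.val + j.val + 1 = 3 then (1 : L) else 0) w.1) := by
    rw [placeForm_antidiagThree_eq_over L w]; exact hU
  refine ⟨(localNonsplitEquiv (IsCMField.complexConj L) (Matrix.of fun i j : Fin 3 => if i.val + j.val + 1 = 3 then (1 : L) else 0) (IsCMField.complexConj_ne_one L) w hw).symm ⟨g, hU'⟩, ?_, ?_⟩
  · rw [mem_cmLocalIntegralLevel_iff_isIntMatrix L 3 (Matrix.of fun i j : Fin 3 => if i.val + j.val + 1 = 3 then (1 : L) else 0) (IsCMField.complexConj_ne_one L) w hw,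
      ContinuousMulEquiv.apply_symm_apply]
    exact ⟨hg, hginv⟩
  · rw [ContinuousMulEquiv.apply_symm_apply]

/-! ## §2  The three conjugates -/

/-- **CLASS `+` MEETS `supp f_{T+}`**: a transvection `γ` of `G` (`X ≠ 0`, `X² = 0`) with `NormClassPlus` has a conjugate `y γ y⁻¹` in
`K ∩ {NearTransvShell ϖ ℓ₀ m* ∧ LabelPlus}` — namely `g₊ = ψ⁻¹ n(t₊)` (`X = xPlus`; ★ `isConj_of_normClassPlus`). [cite: Rogawski1990, §3.9 p. 32] -/
theorem exists_conj_mem_transvPlus (he : v.asIdeal.ramificationIdx' w.1.asIdeal ≠ 1) (ϖ : w.1.adicCompletion L) (hϖ : Valued.v ϖ = WithZero.exp (-1 : ℤ))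
    {γ : ((UnitaryGroup.cmDatum L 3 (Matrix.of fun i j : Fin 3 => if i.val + j.val + 1 = 3 then (1 : L) else 0)).Local v)}
    (h0 : wMatrix L w hw γ - 1 ≠ 0) (hsq : (wMatrix L w hw γ - 1) * (wMatrix L w hw γ - 1) = 0)
    (hN : NormClassPlus (galAdicCompletionMap (L := L) (IsCMField.complexConj L) hw) ϖ (dOfPlace L v w) (wMatrix L w hw γ - 1)) :
    ∃ y : ((UnitaryGroup.cmDatum L 3 (Matrix.of fun i j : Fin 3 => if i.val + j.val + 1 = 3 then (1 : L) else 0)).Local v),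
      y * γ * y⁻¹ ∈ {u : ((UnitaryGroup.cmDatum L 3 (Matrix.of fun i j : Fin 3 => if i.val + j.val + 1 = 3 then (1 : L) else 0)).Local v) |
        u ∈ cmLocalIntegralLevel L 3 (Matrix.of fun i j : Fin 3 => if i.val + j.val + 1 = 3 then (1 : L) else 0) v ∧
        NearTransvShell ϖ (dOfPlace L v w % 2) (mstarFn L v w) (wMatrix L w hw u - 1) ∧
        LabelPlus (galAdicCompletionMap (L := L) (IsCMField.complexConj L) hw) ϖ (dOfPlace L v w) (mstarFn L v w) (wMatrix L w hw u - 1)} := by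
  obtain ⟨d, t, hD⟩ := exists_isRamifiedQuadraticDatum_of_placesOver L w hw he ϖ hϖ
  have hdd : dOfPlace L v w = d := dOfPlace_eq_of_isRamifiedQuadraticDatum L w hw he hD
  obtain ⟨hσσ, hvσ, -, -, hdv, h1d, -⟩ := id hD
  rw [hdd] at hN ⊢
  obtain ⟨tp, htpdef⟩ : ∃ tp : w.1.adicCompletion L,
      (ϖ - galAdicCompletionMap (L := L) (IsCMField.complexConj L) hw ϖ) * ((ϖ * galAdicCompletionMap (L := L) (IsCMField.complexConj L) hw ϖ) ^ ((d - d % 2) / 2))⁻¹ = tp := ⟨_, rfl⟩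
  have htp0 : tp ≠ 0 := by rw [← htpdef]; exact refSkewScalar_ne_zero hvσ hϖ hdv
  have hvtp : Valued.v tp ≤ 1 := by
    rw [← htpdef, v_refSkewScalar hvσ hϖ hdv, ← exp_zero, exp_le_exp]; omega
  have hskew : galAdicCompletionMap (L := L) (IsCMField.complexConj L) hw tp + tp = 0 := by
    rw [← htpdef, map_refSkewScalar_eq_neg hσσ]; ring
  obtain ⟨n, hn, hninv⟩ := exists_units_coe_eq_cornerUnipotent tp
  have hnU : n ∈ unitaryGroupOfForm (galAdicCompletionMap (L := L) (IsCMField.complexConj L) hw) ((StdForm.antidiagonal 3).over (w.1.adicCompletion L)) :=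
    (mem_unitaryGroupOfForm_iff_of_coe_eq_cornerUnipotent _ hn).2 hskew
  obtain ⟨hint, hint'⟩ := isIntMatrix_corner hvtp
  obtain ⟨g, hgK, hψg⟩ := exists_mem_level_coe_eq L w hw hnU (by rw [hn]; exact hint) (by rw [hninv]; exact hint')
  have hwg : wMatrix L w hw g - 1 = xPlus (galAdicCompletionMap (L := L) (IsCMField.complexConj L) hw) ϖ d := by
    have h := corner_sub_one_eq_smul_xPlus (galAdicCompletionMap (L := L) (IsCMField.complexConj L) hw) ϖ 1 d
    rw [one_mul, one_smul, htpdef] at h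
    unfold wMatrix
    rw [hψg, hn]
    exact h
  have hsh : NearTransvShell ϖ (d % 2) (mstarFn L v w) (xPlus (galAdicCompletionMap (L := L) (IsCMField.complexConj L) hw) ϖ d) :=
    nearTransvShell_xPlus hvσ hϖ hdv _
  have h0' : wMatrix L w hw g - 1 ≠ 0 := by
    rw [hwg]; exact fun h => hsh.2.1 (by rw [h]; exact inLevel_zero ϖ _)
  have hsq' : (wMatrix L w hw g - 1) * (wMatrix L w hw g - 1) = 0 := by rw [hwg]; exact xPlus_mul_xPlus _ ϖ d
  have hN' : NormClassPlus (galAdicCompletionMap (L := L) (IsCMField.complexConj L) hw) ϖ d (wMatrix L w hw g - 1) := by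
    rw [hwg]; exact normClassPlus_xPlus _ (by rw [htpdef]; exact htp0)
  obtain ⟨c, hc⟩ := isConj_iff.1 (isConj_of_normClassPlus L w hw ϖ d h0 hsq hN h0' hsq' hN')
  refine ⟨c, ?_⟩
  rw [Set.mem_setOf_eq, hc, hwg]
  exact ⟨hgK, hsh, labelPlus_xPlus _ ϖ d _⟩

/-- **CLASS `−` MEETS `supp f_{T−}`** (ramified `σ`-stable place, `ϖ` a uniformiser): a transvection `γ` of `G` (`X ≠ 0`, `X² = 0`) WITHOUT `NormClassPlus` has a conjugate in
`K ∩ {NearTransvShell ϖ ℓ₀ m* ∧ ¬LabelPlus}` — namely `g₋ = ψ⁻¹ n(ε·t₊)` with `ε` a `σ_w`-fixed unit non-norm (★ `IsCMField.exists_fixed_nonnorm_dichotomy` rescaled by a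
power of `N(ϖ)`; ★ `isConj_of_not_normClassPlus`; `¬LabelPlus` by ★ `not_labelPlus_smul_xPlus` over the complete field `L_w`).
[cite: Rogawski1990, §3.9 p. 32] [cite: Serre1979, Ch. V §3 Cor. 3] -/
theorem exists_conj_mem_transvMinus (he : v.asIdeal.ramificationIdx' w.1.asIdeal ≠ 1) (ϖ : w.1.adicCompletion L) (hϖ : Valued.v ϖ = WithZero.exp (-1 : ℤ))
    {γ : ((UnitaryGroup.cmDatum L 3 (Matrix.of fun i j : Fin 3 => if i.val + j.val + 1 = 3 then (1 : L) else 0)).Local v)}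
    (h0 : wMatrix L w hw γ - 1 ≠ 0) (hsq : (wMatrix L w hw γ - 1) * (wMatrix L w hw γ - 1) = 0)
    (hN : ¬ NormClassPlus (galAdicCompletionMap (L := L) (IsCMField.complexConj L) hw) ϖ (dOfPlace L v w) (wMatrix L w hw γ - 1)) :
    ∃ y : ((UnitaryGroup.cmDatum L 3 (Matrix.of fun i j : Fin 3 => if i.val + j.val + 1 = 3 then (1 : L) else 0)).Local v),
      y * γ * y⁻¹ ∈ {u : ((UnitaryGroup.cmDatum L 3 (Matrix.of fun i j : Fin 3 => if i.val + j.val + 1 = 3 then (1 : L) else 0)).Local v) |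
        u ∈ cmLocalIntegralLevel L 3 (Matrix.of fun i j : Fin 3 => if i.val + j.val + 1 = 3 then (1 : L) else 0) v ∧
        NearTransvShell ϖ (dOfPlace L v w % 2) (mstarFn L v w) (wMatrix L w hw u - 1) ∧
        ¬ LabelPlus (galAdicCompletionMap (L := L) (IsCMField.complexConj L) hw) ϖ (dOfPlace L v w) (mstarFn L v w) (wMatrix L w hw u - 1)} := by
  haveI : IsAdicComplete 𝓂[w.1.adicCompletion L] 𝒪[w.1.adicCompletion L] := isAdicComplete_valuedMaximalIdeal_valuedInteger_adicCompletion L w.1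
  obtain ⟨d, t, hD⟩ := exists_isRamifiedQuadraticDatum_of_placesOver L w hw he ϖ hϖ
  have hdd : dOfPlace L v w = d := dOfPlace_eq_of_isRamifiedQuadraticDatum L w hw he hD
  have hmm : mstarFn L v w = mstarOfRecord d := mstarFn_eq_of_isRamifiedQuadraticDatum L w hw he hD
  obtain ⟨hσσ, hvσ, -, heven, hdv, h1d, -⟩ := id hD
  rw [hdd] at hN ⊢
  -- a `σ_w`-fixed UNIT non-norm `ε`
  obtain ⟨ε₀, hε₀fix, hε₀0, hε₀nn⟩ : ∃ ε₀ : w.1.adicCompletion L, galAdicCompletionMap (L := L) (IsCMField.complexConj L) hw ε₀ = ε₀ ∧ ε₀ ≠ 0 ∧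
      ∀ z : w.1.adicCompletion L, z * galAdicCompletionMap (L := L) (IsCMField.complexConj L) hw z ≠ ε₀ := by
    -- (★ `IsCMField.exists_fixed_nonnorm_dichotomy`, read in the `PlacesOver` currency of this file)
    obtain ⟨ε₀, h1, h2, h3, -⟩ := IsCMField.exists_fixed_nonnorm_dichotomy L w hw
    exact ⟨ε₀, h1, h2, h3⟩
  obtain ⟨n₀, hn₀⟩ := heven ε₀ hε₀fix hε₀0
  have hϖ0 : ϖ ≠ 0 := fun h => by rw [h, map_zero] at hϖ; exact (exp_ne_zero hϖ.symm).elim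
  have hσϖ0 : galAdicCompletionMap (L := L) (IsCMField.complexConj L) hw ϖ ≠ 0 := (map_ne_zero _).2 hϖ0
  obtain ⟨ε, hεdef⟩ : ∃ ε : w.1.adicCompletion L, ε₀ * ((ϖ * galAdicCompletionMap (L := L) (IsCMField.complexConj L) hw ϖ) ^ (n₀ : ℤ) : w.1.adicCompletion L) = ε := ⟨_, rfl⟩
  have hεfix : galAdicCompletionMap (L := L) (IsCMField.complexConj L) hw ε = ε := by
    rw [← hεdef, map_mul, map_zpow₀, map_varpi_mul_map hσσ, hε₀fix]
  have hvε : Valued.v ε = 1 := by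
    rw [← hεdef, map_mul, map_zpow₀, map_mul, hvσ, hϖ, hn₀, ← exp_add, ← exp_zsmul, ← exp_add, ← exp_zero]
    congr 1; ring
  have hεnn : ∀ z : w.1.adicCompletion L, z * galAdicCompletionMap (L := L) (IsCMField.complexConj L) hw z ≠ ε := by
    intro z hz
    have hP : (ϖ ^ n₀ * galAdicCompletionMap (L := L) (IsCMField.complexConj L) hw ϖ ^ n₀) ≠ 0 := mul_ne_zero (zpow_ne_zero _ hϖ0) (zpow_ne_zero _ hσϖ0)
    refine hε₀nn (z * (ϖ ^ n₀)⁻¹) ?_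
    have hσz : galAdicCompletionMap (L := L) (IsCMField.complexConj L) hw (z * (ϖ ^ n₀)⁻¹) =
        galAdicCompletionMap (L := L) (IsCMField.complexConj L) hw z * (galAdicCompletionMap (L := L) (IsCMField.complexConj L) hw ϖ ^ n₀)⁻¹ := by
      rw [map_mul, map_inv₀, map_zpow₀]
    calc z * (ϖ ^ n₀)⁻¹ * galAdicCompletionMap (L := L) (IsCMField.complexConj L) hw (z * (ϖ ^ n₀)⁻¹)
        = z * galAdicCompletionMap (L := L) (IsCMField.complexConj L) hw z * (ϖ ^ n₀ * galAdicCompletionMap (L := L) (IsCMField.complexConj L) hw ϖ ^ n₀)⁻¹ := by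
          rw [hσz, mul_inv]; ring
      _ = ε₀ * (ϖ ^ n₀ * galAdicCompletionMap (L := L) (IsCMField.complexConj L) hw ϖ ^ n₀) * (ϖ ^ n₀ * galAdicCompletionMap (L := L) (IsCMField.complexConj L) hw ϖ ^ n₀)⁻¹ := by
          rw [hz, ← hεdef, mul_zpow, mul_assoc]
      _ = ε₀ := mul_inv_cancel_right₀ hP ε₀
  -- the reference element `g₋ = ψ⁻¹ n(ε t₊)`
  obtain ⟨tp, htpdef⟩ : ∃ tp : w.1.adicCompletion L,
      (ϖ - galAdicCompletionMap (L := L) (IsCMField.complexConj L) hw ϖ) * ((ϖ * galAdicCompletionMap (L := L) (IsCMField.complexConj L) hw ϖ) ^ ((d - d % 2) / 2))⁻¹ = tp := ⟨_, rfl⟩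
  have hvtp : Valued.v (ε * tp) ≤ 1 := by
    rw [map_mul, hvε, one_mul, ← htpdef, v_refSkewScalar hvσ hϖ hdv, ← exp_zero, exp_le_exp]; omega
  have hskew : galAdicCompletionMap (L := L) (IsCMField.complexConj L) hw (ε * tp) + ε * tp = 0 := by
    rw [map_mul, hεfix, ← htpdef, map_refSkewScalar_eq_neg hσσ]; ring
  obtain ⟨n, hn, hninv⟩ := exists_units_coe_eq_cornerUnipotent (ε * tp)
  have hnU : n ∈ unitaryGroupOfForm (galAdicCompletionMap (L := L) (IsCMField.complexConj L) hw) ((StdForm.antidiagonal 3).over (w.1.adicCompletion L)) :=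
    (mem_unitaryGroupOfForm_iff_of_coe_eq_cornerUnipotent _ hn).2 hskew
  obtain ⟨hint, hint'⟩ := isIntMatrix_corner hvtp
  obtain ⟨g, hgK, hψg⟩ := exists_mem_level_coe_eq L w hw hnU (by rw [hn]; exact hint) (by rw [hninv]; exact hint')
  have hwg : wMatrix L w hw g - 1 = ε • xPlus (galAdicCompletionMap (L := L) (IsCMField.complexConj L) hw) ϖ d := by
    have h := corner_sub_one_eq_smul_xPlus (galAdicCompletionMap (L := L) (IsCMField.complexConj L) hw) ϖ ε d
    rw [htpdef] at h
    unfold wMatrix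
    rw [hψg, hn]
    exact h
  have hsh : NearTransvShell ϖ (d % 2) (mstarFn L v w) (ε • xPlus (galAdicCompletionMap (L := L) (IsCMField.complexConj L) hw) ϖ d) :=
    nearTransvShell_smul_xPlus hvσ hϖ hdv hvε _
  have h0' : wMatrix L w hw g - 1 ≠ 0 := by
    rw [hwg]; exact fun h => hsh.2.1 (by rw [h]; exact inLevel_zero ϖ _)
  have hsq' : (wMatrix L w hw g - 1) * (wMatrix L w hw g - 1) = 0 := by
    rw [hwg, Matrix.smul_mul, Matrix.mul_smul, xPlus_mul_xPlus, smul_zero, smul_zero]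
  have hN' : ¬ NormClassPlus (galAdicCompletionMap (L := L) (IsCMField.complexConj L) hw) ϖ d (wMatrix L w hw g - 1) := by
    rw [hwg]; exact not_normClassPlus_smul_xPlus _ ϖ d hεnn
  obtain ⟨c, hc⟩ := isConj_iff.1 (isConj_of_not_normClassPlus L w hw he ϖ hϖ d h0 hsq hN h0' hsq' hN')
  refine ⟨c, ?_⟩
  rw [Set.mem_setOf_eq, hc, hwg]
  refine ⟨hgK, hsh, ?_⟩
  rw [hmm]
  exact not_labelPlus_smul_xPlus hD hεfix hεnn

/-- **THE REGULAR CLASS MEETS `supp f_reg`**: a unipotent `γ` of `G` (`(γ − 1)³ = 0` in `GL₃(L ⊗ L⁺_v)`) with `(wMatrix γ − 1)² ≠ 0` has a conjugate in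
`K ∩ {X² ∉ ϖ^{m*} M₃(𝒪_w)}` — namely `g_reg = ψ⁻¹ u(a, b)` of ★ `exists_regular_entries` (both `ψγ` and `u(a,b)` are `U(σ_w, Φ₃)`-conjugate to `u(1, −1∕2)`, ★
`exists_conj_eq_of_regular_unipotent`; `2 ≠ 0` in characteristic `0`). [cite: Rogawski1990, Proposition 3.9.1 p. 32] -/
theorem exists_conj_mem_reg (he : v.asIdeal.ramificationIdx' w.1.asIdeal ≠ 1) (ϖ : w.1.adicCompletion L) (hϖ : Valued.v ϖ = WithZero.exp (-1 : ℤ))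
    {γ : ((UnitaryGroup.cmDatum L 3 (Matrix.of fun i j : Fin 3 => if i.val + j.val + 1 = 3 then (1 : L) else 0)).Local v)}
    (hγ3 : (((γ.val : GL (Fin 3) (UnitaryGroup.LocalRing L v)).val - 1) ^ 3) = 0)
    (hreg : (wMatrix L w hw γ - 1) * (wMatrix L w hw γ - 1) ≠ 0) :
    ∃ y : ((UnitaryGroup.cmDatum L 3 (Matrix.of fun i j : Fin 3 => if i.val + j.val + 1 = 3 then (1 : L) else 0)).Local v),
      y * γ * y⁻¹ ∈ {u : ((UnitaryGroup.cmDatum L 3 (Matrix.of fun i j : Fin 3 => if i.val + j.val + 1 = 3 then (1 : L) else 0)).Local v) |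
        u ∈ cmLocalIntegralLevel L 3 (Matrix.of fun i j : Fin 3 => if i.val + j.val + 1 = 3 then (1 : L) else 0) v ∧
        ¬ InLevel ϖ (mstarFn L v w) ((wMatrix L w hw u - 1) * (wMatrix L w hw u - 1))} := by
  obtain ⟨d, t, hD⟩ := exists_isRamifiedQuadraticDatum_of_placesOver L w hw he ϖ hϖ
  have hmm : mstarFn L v w = mstarOfRecord d := mstarFn_eq_of_isRamifiedQuadraticDatum L w hw he hD
  obtain ⟨hσσ, hvσ, -, -, -, -, -⟩ := id hD
  obtain ⟨-, h20⟩ := galAdicCompletionMap_involutive_and_two_ne_zero L w hw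
  obtain ⟨a, b, ha, hb, hab, hlt⟩ := exists_regular_entries hD
  have hσa : Valued.v (-galAdicCompletionMap (L := L) (IsCMField.complexConj L) hw a) ≤ 1 := by rw [Valuation.map_neg, hvσ]; exact ha
  obtain ⟨n, hn, hninv⟩ := exists_units_coe_eq_upperTriangularUnipotent a b (-galAdicCompletionMap (L := L) (IsCMField.complexConj L) hw a)
  have hnU : n ∈ unitaryGroupOfForm (galAdicCompletionMap (L := L) (IsCMField.complexConj L) hw) ((StdForm.antidiagonal 3).over (w.1.adicCompletion L)) :=
    (mem_unitaryGroupOfForm_iff_of_coe_eq_upperUnipotent _ hσσ hn).2 ⟨rfl, hab⟩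
  obtain ⟨g, hgK, hψg⟩ := exists_mem_level_coe_eq L w hw hnU (by rw [hn]; exact isIntMatrix_upperUnipotent ha hb hσa)
    (by rw [hninv]; exact isIntMatrix_upper_inv ha hb hσa)
  have hwg : wMatrix L w hw g = !![1, a, b; 0, 1, -galAdicCompletionMap (L := L) (IsCMField.complexConj L) hw a; 0, 0, 1] := by
    unfold wMatrix; rw [hψg, hn]
  -- regularity and nilpotency of both
  have haa : a * galAdicCompletionMap (L := L) (IsCMField.complexConj L) hw a ≠ 0 := fun h => by
    rw [h, map_zero] at hlt; exact (not_lt.2 zero_le) hlt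
  have hreg' : ((n : Matrix (Fin 3) (Fin 3) (w.1.adicCompletion L)) - 1) * ((n : Matrix (Fin 3) (Fin 3) (w.1.adicCompletion L)) - 1) ≠ 0 := by
    rw [hn, upperUnipotent_sub_one_mul_self]
    intro h
    have h02 := congr_fun (congr_fun h 0) 2
    have e : (!![0, 0, a * -galAdicCompletionMap (L := L) (IsCMField.complexConj L) hw a; 0, 0, 0; 0, 0, 0] : Matrix (Fin 3) (Fin 3) (w.1.adicCompletion L)) 0 2 =
        a * -galAdicCompletionMap (L := L) (IsCMField.complexConj L) hw a := rfl
    rw [e, Matrix.zero_apply, mul_neg, neg_eq_zero] at h02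
    exact haa h02
  have hnil' : IsNilpotent ((n : Matrix (Fin 3) (Fin 3) (w.1.adicCompletion L)) - 1) := ⟨3, by rw [hn]; exact upper_sub_one_pow_three a b _⟩
  have hnil : IsNilpotent (wMatrix L w hw γ - 1) := ⟨3, wMatrix_sub_one_pow_eq_zero L w hw hγ3⟩
  obtain ⟨k, hk, hkk⟩ := exists_conj_eq_of_regular_unipotent (galAdicCompletionMap (L := L) (IsCMField.complexConj L) hw) hσσ h20
    (F0P3cDyRamProfilePiecesProps.coe_mem_unitaryGroupOfForm_over L w hw γ) hnU hnil hnil' hreg hreg'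
  have hconj : IsConj γ g := by
    refine isConj_of_conj_conj_eq L w hw hk (one_mem _) (one_mem _) ?_
    rw [one_mul, inv_one, mul_one, one_mul, mul_one, hkk, hψg]
  obtain ⟨c, hc⟩ := isConj_iff.1 hconj
  refine ⟨c, ?_⟩
  rw [Set.mem_setOf_eq, hc, hwg, hmm]
  exact ⟨hgK, not_inLevel_upper_sub_one_sq _ hϖ b hlt⟩

end Summit.HodgeConjecture.HodgeConjecture.Cruxes.H413.F0P3cDyRamTableDiagConjugates

end
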